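import Summits.BirchSwinnertonDyer.BirchSwinnertonDyer.Theorems.AdditiveBranchIMCGenusGrossZagierSplit
import Summits.BirchSwinnertonDyer.BirchSwinnertonDyer.Theorems.AdditiveBranchIMCGenusGrossZagierTwistUnits
import Summits.BirchSwinnertonDyer.Rank1Residual.Additive.GordBranchMeetsField
import Summits.BirchSwinnertonDyer.Rank1Residual.Additive.GordTwistMinimalModel
import Summits.BirchSwinnertonDyer.Rank1Residual.Additive.N10LowerHalfStatements
import Summits.BirchSwinnertonDyer.Rank1Residual.X11b.BDPRouteManin
import Literature.NumberTheory.EllipticCurves.LeadingTermBSZOrdinaryProofs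
import Literature.NumberTheory.EllipticCurves.RootNumberTwistSemistableProofs
import Literature.NumberTheory.EllipticCurves.RootNumberProofs
import Literature.NumberTheory.EllipticCurves.RootNumberSmulProofs
import Literature.NumberTheory.EllipticCurves.ModularParametrizationBCDTProofs
import Literature.NumberTheory.EllipticCurves.NeronIsogenyScalingHoldsProofs
import Literature.NumberTheory.EllipticCurves.IrreducibleModPQuadraticTwistProofs
import Literature.NumberTheory.EllipticCurves.OpenImageMazurAssemblyProofs
import Literature.NumberTheory.EllipticCurves.QuadraticTwistPadicReduction
import Literature.NumberTheory.EllipticCurves.GlobalMinimalModelProofs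
import Literature.NumberTheory.DiophantineGeometry.ConductorFactorizationProofs
import Literature.NumberTheory.DiophantineGeometry.ConductorExponentZeroProofs
import HarnessLib

/-!
# Route `AdditiveBranchIMC`, crux `GordTwoRankZeroOffCaseOne` (stmt-19357), line `three-field-road`,
# stub U-a (`stub_genusGrossZagier`) — part 5b: THE FOURTH CURVE `E′` on the (G-ord) road —
# a globally minimal model of `Wd ⊗ χ_{d₁}`, GOOD at `p`, with the two presentations
# `C₁ • E′^{(d₁)} = Wd`, `C₂′ • E′^{(d₂)} = A`, `p`-unit scalings, and a datum with `p ∤ c`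

Cell `bsd-addord`, seat `bsd-line-addord-w4` (stub-worker under the lead of crux 19357). HONEST
FRAMING: helper theorems only (no `def`, no named fact, nothing asserted about BSD; the crux stays
OPEN). This is the part of the road residue `road_fourthCurve_gord` (see the seat's notes and the
assembly `…GenusGrossZagierAssembly.lean`) that does not involve Cai–Shu–Tian's Heegner condition:
given the (G-ord, `e = 2`) curve `Wd` at `p ≥ 5` (`N10.CellGordTwo`: `Wd ≅ V^{(p*)}`, `V` good ordinary at
`p`), its partner `A ≅ Wd^{(d_{K″})}`, `Wd[p]` irreducible, and a genus factorisation `d₁ d₂ = D` of a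
fundamental discriminant `D` with `d₁` fundamental and `p ∣ d₁`:

* `not_sq_dvd_of_isFundamental_of_ne_two`, `not_dvd_conductorNorm_iff_hasGoodReductionAtPrime` —
  bookkeeping (`p² ∤ D` at odd `p`; `p ∤ N_E ⟺ E` good at `p`, from `N_E = ∏ p^{f_p}` and `f_p = 0 ⟺`
  good, both proved in the tree).
* `exists_fourthCurve_gord` — THE FOURTH CURVE: `E′` globally minimal with `C • Wd^{(d₁)} = E′`,
  `C₁ • E′^{(d₁)} = Wd` and `C₂′ • E′^{(d₂)} = A` (twisting twice by `d₁` is a square twist; Silverman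
  X.5 Cor. 5.4), `E′` GOOD at `p` (`E′ ≅ V^{(d₁/p*)}` with `p ∤ d₁/p*`: an unramified twist of the good
  curve `V`, Silverman VII.5 Prop. 5.1 — tree `hasReductionAt_quadraticTwist_iff_of_not_dvd`),
  `ord_p u(C₁) = ord_p u(C₂′) = 0` (part 3b: Pal 2012 Prop. 2.5), and a parametrisation datum `Dt` of
  `E′` at level `N_{E′}` with `p ∤ c(Dt)` (Mazur 1978 Cor. 4.1 on the optimal curve, `p ∤ N_{E′}`, and a
  prime-to-`p` isogeny since `E′[p] ≅ Wd[p] ⊗ χ` is irreducible — tree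
  `X11b.exists_modularParametrizationData_not_dvd`, fed by `nonempty_modularParametrizationData`,
  `mazur_not_dvd_maninConstant_of_odd` and the proved Néron scaling property).

What remains of `road_fourthCurve_gord` after this file: the genus split of `d_{K″}` along
`{p} ∪ T` (part 5a gives the splitting engine) and Cai–Shu–Tian's Heegner condition (1)–(2) for
`(E′, K″, 1)`.

References: Silverman AEC VII.5 Prop. 5.1, X.5 Cor. 5.4, C.16; Pal 2012 Prop. 2.5; Mazur 1978
Cor. 4.1; Jetchev–Skinner–Wan 2017 §7.4.1 (Manin constant along a prime-to-`p` isogeny).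
-/

noncomputable section

open scoped Classical

open WeierstrassCurve NumberField IsDedekindDomain Rat.HeightOneSpectrum
  Literature.NumberTheory.EllipticCurves
  Literature.NumberTheory.EllipticCurves.ModularForms
  Literature.NumberTheory.EllipticCurves.Rank1Residual
  Summit.BirchSwinnertonDyer.Rank1Residual
  Summit.BirchSwinnertonDyer.Rank1Residual.Additive

-- D-0017 layout: summit = sub-problem, so `Summit.BirchSwinnertonDyer.BirchSwinnertonDyer.…` is the
-- mandated namespace (same option as the route's sockets files).
set_option linter.dupNamespace false
set_option autoImplicit false

namespace Summit.BirchSwinnertonDyer.BirchSwinnertonDyer.Theorems.GenusGrossZagier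

/-! ## §1 Bookkeeping -/

/-- **No odd square divides a fundamental discriminant**: `p² ∤ D` for `p` an odd prime.
[cite: Cox2013, §3.B (fundamental discriminants)] -/
theorem not_sq_dvd_of_isFundamental_of_ne_two {D : ℤ}
    (hD : (D % 4 = 1 ∧ Squarefree D ∧ D ≠ 1) ∨
      (4 ∣ D ∧ (D / 4 % 4 = 2 ∨ D / 4 % 4 = 3) ∧ Squarefree (D / 4)))
    {p : ℕ} (hp : p.Prime) (hp2 : p ≠ 2) : ¬ (p : ℤ) ^ 2 ∣ D := by
  have hpZ : Prime (p : ℤ) := Nat.prime_iff_prime_int.mp hp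
  rw [sq]
  intro h
  rcases hD with ⟨-, hsq, -⟩ | ⟨h4, -, hsq⟩
  · exact hpZ.not_unit (hsq _ h)
  · obtain ⟨m, rfl⟩ := h4
    rw [Int.mul_ediv_cancel_left _ four_ne_zero] at hsq
    have h1 : IsCoprime (p : ℤ) 2 := by
      refine (Irreducible.coprime_iff_not_dvd hpZ.irreducible).mpr fun h => hp2 ?_
      exact le_antisymm (by exact_mod_cast Int.le_of_dvd two_pos h) hp.two_le
    have hcop : IsCoprime ((p : ℤ) * p) 4 := by
      have h4' : IsCoprime (p : ℤ) 4 := by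
        rw [show (4 : ℤ) = 2 * 2 by norm_num]; exact h1.mul_right h1
      exact h4'.mul_left h4'
    exact hpZ.not_unit (hsq _ (hcop.dvd_of_dvd_mul_left h))

/-- **`p ∤ N_E ⟺ E` has good reduction at `p`** (`N_E = ∏ p^{f_p}`, tree `factorization_conductorNorm_holds`;
`f_p = 0 ⟺` good, tree `conductorExponent_eq_zero_iff_holds`; prime-indexed good reduction through
`hasGoodReductionAtPrime_primesEquiv_iff_hasGoodReductionAt`). [cite: Silverman1994, IV.10.2(a)]
[cite: SilvermanAEC2009, C.16 (definition of the conductor)] -/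
theorem not_dvd_conductorNorm_iff_hasGoodReductionAtPrime (W : WeierstrassCurve ℚ) [W.IsElliptic]
    (p : ℕ) [hp : Fact p.Prime] : ¬ p ∣ W.conductorNorm ℤ ↔ W.HasGoodReductionAtPrime p := by
  obtain ⟨v, rfl⟩ : ∃ v : HeightOneSpectrum ℤ, (primesEquiv v : ℕ) = p :=
    ⟨primesEquiv.symm ⟨p, hp.out⟩, by rw [Equiv.apply_symm_apply]⟩
  rw [hasGoodReductionAtPrime_primesEquiv_iff_hasGoodReductionAt,
    ← conductorExponent_eq_zero_iff_holds v W, ← factorization_conductorNorm_holds W v]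
  have hpos : W.conductorNorm ℤ ≠ 0 := (W.conductorNorm_pos_holds).ne'
  constructor
  · intro h
    exact Nat.factorization_eq_zero_of_not_dvd h
  · intro h hdvd
    exact ((primesEquiv v).2.factorization_pos_of_dvd hpos hdvd).ne' h

/-! ## §2 The fourth curve on the (G-ord) road -/

/-- **The fourth curve `E′` of the three-field road ((G-ord), rank `0`).** For globally minimal
`Wd`, `A` with `Wd` in the (G-ord, `e = 2`) cell at `p ≥ 5` (`p ≠ 2` suffices), `Wd[p]` irreducible,
`C • Wd^{(D)} = A`, and `D` fundamental with a factorisation `d₁ d₂ = D`, `d₁` fundamental, `p ∣ d₁`: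
there are a GLOBALLY MINIMAL `E′ ≅ Wd^{(d₁)}` with `C₁ • E′^{(d₁)} = Wd`, `C₂′ • E′^{(d₂)} = A`,
`ord_p u(C₁) = ord_p u(C₂′) = 0`, a datum `Dt` of `E′` at level `N_{E′}` with `p ∤ c(Dt)`, and `E′`
has GOOD reduction at `p`. Inputs by name: `nonempty_modularParametrizationData` (BCDT),
`mazur_not_dvd_maninConstant_of_odd` (Mazur 1978 Cor. 4.1). [cite: SilvermanAEC2009, X.5 Cor. 5.4 and VII.5 Prop. 5.1]
[cite: Pal2012, Prop. 2.5] [cite: Mazur1978, Cor. 4.1] [cite: JetchevSkinnerWan2017, §7.4.1 and Remark 43] -/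
theorem exists_fourthCurve_gord (hmodP : nonempty_modularParametrizationData)
    (hMaz : mazur_not_dvd_maninConstant_of_odd)
    (Wd A : WeierstrassCurve ℚ) [Wd.IsElliptic] [Wd.IsGloballyMinimal] [A.IsElliptic]
    [A.IsGloballyMinimal] (p : ℕ) [Fact p.Prime] (hcell : N10.CellGordTwo Wd p)
    (hirr : Wd.HasIrreducibleModPGaloisRep p) {D d₁ d₂ : ℤ}
    (hD : (D % 4 = 1 ∧ Squarefree D ∧ D ≠ 1) ∨
      (4 ∣ D ∧ (D / 4 % 4 = 2 ∨ D / 4 % 4 = 3) ∧ Squarefree (D / 4)))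
    (hd₁ : (d₁ % 4 = 1 ∧ Squarefree d₁ ∧ d₁ ≠ 1) ∨
      (4 ∣ d₁ ∧ (d₁ / 4 % 4 = 2 ∨ d₁ / 4 % 4 = 3) ∧ Squarefree (d₁ / 4)))
    (hd : d₁ * d₂ = D) (hpd : (p : ℤ) ∣ d₁)
    (htwA : ∃ C : VariableChange ℚ, C • Wd.quadraticTwist (D : ℚ) = A) :
    ∃ (E' : WeierstrassCurve ℚ) (_ : E'.IsElliptic) (_ : E'.IsGloballyMinimal)
      (_ : NeZero (E'.conductorNorm ℤ)) (C₁ C₂' : VariableChange ℚ)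
      (Dt : ModularParametrizationData E' (E'.conductorNorm ℤ)),
      (∃ C : VariableChange ℚ, C • Wd.quadraticTwist (d₁ : ℚ) = E') ∧
      C₁ • E'.quadraticTwist (d₁ : ℚ) = Wd ∧ C₂' • E'.quadraticTwist (d₂ : ℚ) = A ∧
      padicValRat p (C₁.u : ℚ) = 0 ∧ padicValRat p (C₂'.u : ℚ) = 0 ∧ ¬ (p : ℤ) ∣ Dt.c ∧
      E'.HasGoodReductionAtPrime p := by
  have hp : p.Prime := Fact.out
  obtain ⟨hp2, hadd, hG, he⟩ := hcell
  -- §a arithmetic of `d₁ = p* · d₁'`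
  have hd10 : d₁ ≠ 0 := by rintro rfl; rcases hd₁ with ⟨h, -, -⟩ | ⟨-, h, -⟩ <;> norm_num at h
  have hd1Q : (d₁ : ℚ) ≠ 0 := by exact_mod_cast hd10
  have hD0 : D ≠ 0 := by rintro rfl; rcases hD with ⟨h, -, -⟩ | ⟨-, h, -⟩ <;> norm_num at h
  have hDQ : (D : ℚ) ≠ 0 := by exact_mod_cast hD0
  have hd20 : d₂ ≠ 0 := by rintro rfl; rw [mul_zero] at hd; exact hD0 hd.symm
  obtain ⟨hcast, hpm⟩ := pStar_intCast p
  set e : ℤ := (-1 : ℤ) ^ (p / 2) * p with hedef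
  have he4 : e % 4 = 1 := by
    obtain ⟨k, hk⟩ := exists_four_mul_add_one_eq_pStar p hp2
    rw [hedef, ← hk]; omega
  obtain ⟨hshape, hde, hnd⟩ := isFundamental_or_eq_one_div_primeDiscr hp hp2 he4 hpm hd₁ hpd
  set d₁' : ℤ := d₁ / e with hd₁'
  have hpsq : ¬ (p : ℤ) ^ 2 ∣ d₁ := not_sq_dvd_of_isFundamental_of_ne_two hd₁ hp hp2
  have hpD : ¬ (p : ℤ) ^ 2 ∣ D := not_sq_dvd_of_isFundamental_of_ne_two hD hp hp2
  have hpd₂ : ¬ (p : ℤ) ∣ d₂ := fun h => hpD (by rw [← hd, sq]; exact mul_dvd_mul hpd h)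
  -- §b the good twist model `V`: `CV • Wd^{(p*)} = V`, `V` good (ordinary) at `p`
  obtain ⟨V, iV, iVm, ⟨CV, hCV⟩, hordV⟩ := TypeGOrd.exists_goodOrd_model_twist_pStar Wd p hp2 hG hadd he
  -- §c the fourth curve: a globally minimal model of `Wd^{(d₁)}`
  haveI := Wd.isElliptic_quadraticTwist hd1Q
  obtain ⟨C', hC'min⟩ := hasGlobalMinimalModel_rat_holds (Wd.quadraticTwist (d₁ : ℚ))
  set E' : WeierstrassCurve ℚ := C' • Wd.quadraticTwist (d₁ : ℚ) with hE'def
  haveI : E'.IsGloballyMinimal := hC'min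
  haveI hnz : NeZero (E'.conductorNorm ℤ) := ⟨(conductorNorm_pos_holds E').ne'⟩
  -- §d `C₁ • E′^{(d₁)} = Wd` (twisting twice by `d₁` is the square twist)
  obtain ⟨C₀, hC₀⟩ := Wd.exists_variableChange_smul_eq_quadraticTwist_sq hd1Q
  have hE'tw : E'.quadraticTwist (d₁ : ℚ) =
      ((⟨C'.u, (d₁ : ℚ) * C'.r, 0, 0⟩ : VariableChange ℚ) * C₀) • Wd := by
    rw [hE'def, WeierstrassCurve.quadraticTwist_smul, quadraticTwist_quadraticTwist, mul_smul, hC₀, sq]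
  set C₁ : VariableChange ℚ := ((⟨C'.u, (d₁ : ℚ) * C'.r, 0, 0⟩ : VariableChange ℚ) * C₀)⁻¹ with hC₁def
  have hC₁ : C₁ • E'.quadraticTwist (d₁ : ℚ) = Wd := by rw [hE'tw, hC₁def, inv_smul_smul]
  -- §e `C₂′ • E′^{(d₂)} = A`: `A ≅ Wd^{(D)} ≅ E′^{(d₁ D)} = E′^{(d₂ d₁²)} ≅ E′^{(d₂)}`
  obtain ⟨CA, hCA⟩ := htwA
  obtain ⟨C₃, hC₃⟩ := E'.exists_variableChange_quadraticTwist_mul_sq (d₂ : ℚ) (d₁ : ℚ) hd1Q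
  have hA' : A = (CA * (⟨C₁.u, (D : ℚ) * C₁.r, 0, 0⟩ : VariableChange ℚ) * C₃) •
      E'.quadraticTwist (d₂ : ℚ) := by
    rw [mul_smul, mul_smul, hC₃, show (d₂ : ℚ) * (d₁ : ℚ) ^ 2 = (d₁ : ℚ) * (D : ℚ) by
      rw [← hd]; push_cast; ring, ← quadraticTwist_quadraticTwist, ← WeierstrassCurve.quadraticTwist_smul, hC₁, hCA]
  set C₂' : VariableChange ℚ := CA * (⟨C₁.u, (D : ℚ) * C₁.r, 0, 0⟩ : VariableChange ℚ) * C₃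
    with hC₂'def
  have hC₂' : C₂' • E'.quadraticTwist (d₂ : ℚ) = A := hA'.symm
  -- §f `E′` is GOOD at `p`: `E′ ≅ V^{(d₁')}` with `p ∤ d₁'`
  have hE'V : E' = (C' * (⟨CV.u, (d₁' : ℚ) * CV.r, 0, 0⟩ : VariableChange ℚ)⁻¹) •
      V.quadraticTwist (d₁' : ℚ) := by
    rw [mul_smul, hE'def]
    congr 1
    rw [← hCV, WeierstrassCurve.quadraticTwist_smul, inv_smul_smul, quadraticTwist_quadraticTwist, ← hcast,
      ← Int.cast_mul, ← hde]
  have hgoodV : V.HasGoodReductionAtPrime p := hordV.1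
  have hgoodE' : E'.HasGoodReductionAtPrime p := by
    rw [hE'V, BSZLemma17.hasGoodReductionAtPrime_smul_iff]
    obtain ⟨v, hv⟩ : ∃ v : HeightOneSpectrum ℤ, (primesEquiv v : ℕ) = p :=
      ⟨primesEquiv.symm ⟨p, hp⟩, by rw [Equiv.apply_symm_apply]⟩
    subst hv
    rw [hasGoodReductionAtPrime_primesEquiv_iff_hasGoodReductionAt]
    exact (V.hasReductionAt_quadraticTwist_iff_of_not_dvd v hp2 hnd).1.mpr
      ((hasGoodReductionAtPrime_primesEquiv_iff_hasGoodReductionAt V v).mp hgoodV)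
  -- §g the scalings are `p`-units (Pal 2012 Prop. 2.5; part 3b)
  have hu₁ : padicValRat p (C₁.u : ℚ) = 0 :=
    padicValRat_u_eq_zero_of_twist_of_dvd E' hp2 hpd hpsq (Or.inl hgoodE') Wd C₁ hC₁
  have hu₂ : padicValRat p (C₂'.u : ℚ) = 0 :=
    padicValRat_u_eq_zero_of_twist_of_not_dvd E' hp2 hpd₂ A C₂' hC₂'
  -- §h a datum with `p ∤ c`: `p ∤ N_{E′}`, `E′[p]` irreducible
  have hpN : ¬ p ^ 2 ∣ E'.conductorNorm ℤ := fun h =>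
    (not_dvd_conductorNorm_iff_hasGoodReductionAtPrime E' p).mpr hgoodE' ((dvd_pow_self p two_ne_zero).trans h)
  have hirrE' : E'.HasIrreducibleModPGaloisRep p := by
    rw [hE'def, Mazur1978.hasIrreducibleModPGaloisRep_smul_iff,
      Wd.hasIrreducibleModPGaloisRep_quadraticTwist_iff hd1Q p]
    exact hirr
  obtain ⟨Dt, hc⟩ := X11b.exists_modularParametrizationData_not_dvd
    (exists_isNewformOf_of_nonempty_modularParametrizationData hmodP) hMaz
    integral_neronScaling_of_isGloballyMinimal_holds E' rfl hp hp2 hpN hirrE'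
  exact ⟨E', inferInstance, hC'min, hnz, C₁, C₂', Dt, ⟨C', rfl⟩, hC₁, hC₂', hu₁, hu₂, hc, hgoodE'⟩

end Summit.BirchSwinnertonDyer.BirchSwinnertonDyer.Theorems.GenusGrossZagier

end
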